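import Summits.PneNP.PneNP.Theorems.Sd2BlMachineDictInst
import Summits.PneNP.PneNP.Theorems.Sd2BlMachineDictSparse
import Summits.PneNP.PneNP.Theorems.Sd2BlMachineGreedy

/-!
# K1'' machine side (S3), DICTIONARY D2i: the decomposition clauses over the certificate legs, at the sd-2 threshold

Cell pnp-ideate, ROUND-18 item K1''.  The generic clauses of D2a/D2b (`decomposition_clausesG`: legs = positions in the
raw-leg list, threshold `√γsq`) transported to the certificate legs `E = SignDeg2Legs.CLeg c` through the bijection
`posOf` of D1i (`pI e := pG … (posOf e)`; counts over `CLeg c` = counts over positions, `card_filter_posOf`), and the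
threshold of the sd-2 machine identified with the pipeline's literal one:
`√(gRsq ℓ t) = 4ℓ · √(34ℓ · 2^(2t) · 2t)` (`sqrt_gRsq`).  Result: `decomposition_clausesI` — hsp / hsides / hdense / hcov
of `Sd2Bl.legBound_of_pipeline` for `src := srcI`, `dst := dstI`, `p := pI`, `V₁ := V₁G`, `V₂ := V₂G` on the machine's
extraction `extract (gRsq ℓ t) plegs (cands plegs cap t₀ u₁) u₂` (cap adequacy `hcap` and round counts as hypotheses,
discharged by the closer from `Sd2BlMachineGreedy`'s `gCands / gExtract` parameters).  Restricted-model algorithmic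
infrastructure; nothing here bears on `P` versus `NP`.
-/

set_option linter.dupNamespace false -- `Summit.PneNP.PneNP.…`: summit = sub-problem name (D-0017 single-conjunct layout)

namespace Summit.PneNP.PneNP.Theorems.Sd2BlMachine

open Literature.Computability.Complexity
open Summit.PneNP.PneNP.Theorems.SfmBlMachine (Lab PLeg walksU cands extract)
open Summit.PneNP.PneNP.Theorems.SfmBl (bipGraph)
open Summit.PneNP.PneNP.Theorems.SignRepCertificate (Cert)
open Summit.PneNP.PneNP.Theorems.SignDeg2Legs (Kind coef CLeg)
open Summit.PneNP.PneNP.Theorems.LocalMapDecodeFP (decode)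

/-! ## The sd-2 threshold -/

/-- `√(gRsq ℓ t) = 4ℓ · √(34ℓ · 2^(2t) · 2t)` — the machine's squared extraction threshold is the square of the
pipeline's sparseness / density constant. -/
theorem sqrt_gRsq (ℓ t : ℕ) :
    Real.sqrt (gRsq ℓ t : ℕ) = 4 * ℓ * Real.sqrt (34 * ℓ * (2 : ℝ) ^ (2 * t) * (2 * t : ℕ)) := by
  have h4 : (0 : ℝ) ≤ 4 * ℓ := by positivity
  have hx : (0 : ℝ) ≤ 34 * ℓ * (2 : ℝ) ^ (2 * t) * (2 * t : ℕ) := by positivity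
  have e : ((gRsq ℓ t : ℕ) : ℝ) = (4 * ℓ) ^ 2 * (34 * ℓ * (2 : ℝ) ^ (2 * t) * (2 * t : ℕ)) := by
    unfold gRsq; push_cast; ring
  rw [e, Real.sqrt_mul (sq_nonneg _), Real.sqrt_sq h4]

/-! ## Counts through the bijection `posOf` -/

variable {k n m : ℕ} (I : LocalMap k n m) (c : Cert I)
  (F0 : ((Fin k → Bool) → Bool) → ℤ) (F1 : ((Fin k → Bool) → Bool) → Fin k → ℤ)
  (F2 : ((Fin k → Bool) → Bool) → Fin k → Fin k → ℤ)
  (hF : ∀ (j : Fin m) (κ : Kind k), coef c j κ = coefF k F0 F1 F2 (I.table j) κ)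

section WithF

include hF

/-- Counting certificate legs by a property of their position = counting positions. -/
theorem card_filter_posOf (P : Fin (rawI I F0 F1 F2).length → Prop) [DecidablePred P] :
    (Finset.univ.filter fun e : CLeg c => P (posOf I c F0 F1 F2 hF e)).card = (Finset.univ.filter P).card := by
  classical
  refine Finset.card_bij (fun e _ => posOf I c F0 F1 F2 hF e) (fun e he => ?_) (fun a _ b _ h => posOf_injective I c F0 F1 F2 hF h)
    (fun i hi => ?_)
  · rw [Finset.mem_filter] at he ⊢; exact ⟨Finset.mem_univ _, he.2⟩
  · obtain ⟨e, rfl⟩ := posOf_surjective I c F0 F1 F2 hF i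
    rw [Finset.mem_filter] at hi
    exact ⟨e, Finset.mem_filter.2 ⟨Finset.mem_univ _, hi.2⟩, rfl⟩

variable (L : ℕ)

/-- The PART of a certificate leg: the part of its position. -/
noncomputable def pI (labels : List ℕ) (r : ℕ) (hlab : ∀ lab ∈ labels, lab ≤ r) (e : CLeg c) : Option (Fin r) :=
  pG (raw := rawI I F0 F1 F2) labels r hlab (posOf I c F0 F1 F2 hF e)

/-- **THE DECOMPOSITION CLAUSES OVER `CLeg c`** at threshold `√γsq`, for the machine's extraction with density constant
`γsq`, candidates from `2(t₀−1)` walk rounds under a non-binding cap, and more than `|raw|` extraction rounds. -/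
theorem decomposition_clausesI (γsq : ℕ) (cap t₀ : ℕ) (u₁ : List Unit) (hu₁ : u₁.length = 2 * (t₀ - 1))
    (hcap : ∀ k', k' ≤ u₁.length → (walksU (pieceLegsG L (rawI I F0 F1 F2)) k').length ≤ cap)
    (u₂ : List Unit) (hu₂ : (pieceLegsG L (rawI I F0 F1 F2)).length < u₂.length) :
    let raw := rawI I F0 F1 F2
    let plegs := pieceLegsG L raw
    let st := extract γsq plegs (cands plegs cap t₀ u₁) u₂
    ∃ hlab : ∀ lab ∈ st.1, lab ≤ st.2,
      (∀ (W₁ : Finset (LPieceG L raw)) (W₂ : Finset (RPieceG L raw)),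
        ((bipGraph (fun i q => ∃ e : CLeg c, srcI I c F0 F1 F2 hF L e = i ∧ dstI I c F0 F1 F2 hF L e = q)).induce
            {x | Sum.elim (fun i => i ∈ W₁) (fun q => q ∈ W₂) x}).Connected →
        W₁.card + W₂.card ≤ t₀ →
        ((Finset.univ.filter fun e : CLeg c =>
            pI I c F0 F1 F2 hF st.1 st.2 hlab e = none ∧ srcI I c F0 F1 F2 hF L e ∈ W₁ ∧ dstI I c F0 F1 F2 hF L e ∈ W₂).card : ℝ)
          ≤ Real.sqrt γsq * Real.sqrt ((W₁.card : ℝ) * (W₂.card : ℝ))) ∧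
      (∀ (s : Fin st.2) (e : CLeg c), pI I c F0 F1 F2 hF st.1 st.2 hlab e = some s →
        srcI I c F0 F1 F2 hF L e ∈ V₁G L raw st.1 st.2 hlab s ∧ dstI I c F0 F1 F2 hF L e ∈ V₂G L raw st.1 st.2 hlab s) ∧
      (∀ s : Fin st.2, Real.sqrt γsq *
          Real.sqrt (((V₁G L raw st.1 st.2 hlab s).card : ℝ) * ((V₂G L raw st.1 st.2 hlab s).card : ℝ))
        < ((Finset.univ.filter fun e : CLeg c => pI I c F0 F1 F2 hF st.1 st.2 hlab e = some s).card : ℝ)) ∧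
      (∀ s : Fin st.2, (V₁G L raw st.1 st.2 hlab s).card + (V₂G L raw st.1 st.2 hlab s).card
        ≤ 2 * (Finset.univ.filter fun e : CLeg c => pI I c F0 F1 F2 hF st.1 st.2 hlab e = some s).card) := by
  intro raw plegs st
  obtain ⟨hlab, hsp, hsides, hdense, hcov⟩ := decomposition_clausesG γsq L raw cap t₀ u₁ hu₁ hcap u₂ hu₂
  refine ⟨hlab, fun W₁ W₂ hconn hsize => ?_, fun s e he => hsides s _ he, fun s => ?_, fun s => ?_⟩
  · -- sparse: transport the connectivity hypothesis and the count
    have hconn' : ((bipGraph (fun i q => ∃ p : Fin raw.length, srcG L raw p = i ∧ dstG L raw p = q)).induce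
        {x | Sum.elim (fun i => i ∈ W₁) (fun q => q ∈ W₂) x}).Connected := by
      have e : (fun i q => ∃ e : CLeg c, srcI I c F0 F1 F2 hF L e = i ∧ dstI I c F0 F1 F2 hF L e = q) =
          (fun i q => ∃ p : Fin raw.length, srcG L raw p = i ∧ dstG L raw p = q) := by
        funext i q; exact propext (exists_leg_iff I c F0 F1 F2 hF L i q)
      rw [e] at hconn; exact hconn
    have h := hsp W₁ W₂ hconn' hsize
    rw [← card_filter_posOf I c F0 F1 F2 hF] at h
    exact h
  · have h := hdense s
    rw [← card_filter_posOf I c F0 F1 F2 hF] at h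
    exact h
  · have h := hcov s
    rw [← card_filter_posOf I c F0 F1 F2 hF] at h
    exact h

/-- The same at the sd-2 threshold: with `γsq = gRsq ℓ t` the constant is the pipeline's `4ℓ·√(34ℓ·2^(2t)·2t)`. -/
theorem decomposition_clausesI_sd2 (ℓ t : ℕ) (cap t₀ : ℕ) (u₁ : List Unit) (hu₁ : u₁.length = 2 * (t₀ - 1))
    (hcap : ∀ k', k' ≤ u₁.length → (walksU (pieceLegsG L (rawI I F0 F1 F2)) k').length ≤ cap)
    (u₂ : List Unit) (hu₂ : (pieceLegsG L (rawI I F0 F1 F2)).length < u₂.length) :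
    let raw := rawI I F0 F1 F2
    let plegs := pieceLegsG L raw
    let st := extract (gRsq ℓ t) plegs (cands plegs cap t₀ u₁) u₂
    ∃ hlab : ∀ lab ∈ st.1, lab ≤ st.2,
      (∀ (W₁ : Finset (LPieceG L raw)) (W₂ : Finset (RPieceG L raw)),
        ((bipGraph (fun i q => ∃ e : CLeg c, srcI I c F0 F1 F2 hF L e = i ∧ dstI I c F0 F1 F2 hF L e = q)).induce
            {x | Sum.elim (fun i => i ∈ W₁) (fun q => q ∈ W₂) x}).Connected →
        W₁.card + W₂.card ≤ t₀ →
        ((Finset.univ.filter fun e : CLeg c =>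
            pI I c F0 F1 F2 hF st.1 st.2 hlab e = none ∧ srcI I c F0 F1 F2 hF L e ∈ W₁ ∧ dstI I c F0 F1 F2 hF L e ∈ W₂).card : ℝ)
          ≤ (4 * ℓ * Real.sqrt (34 * ℓ * (2 : ℝ) ^ (2 * t) * (2 * t : ℕ))) * Real.sqrt ((W₁.card : ℝ) * (W₂.card : ℝ))) ∧
      (∀ (s : Fin st.2) (e : CLeg c), pI I c F0 F1 F2 hF st.1 st.2 hlab e = some s →
        srcI I c F0 F1 F2 hF L e ∈ V₁G L raw st.1 st.2 hlab s ∧ dstI I c F0 F1 F2 hF L e ∈ V₂G L raw st.1 st.2 hlab s) ∧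
      (∀ s : Fin st.2, (4 * ℓ * Real.sqrt (34 * ℓ * (2 : ℝ) ^ (2 * t) * (2 * t : ℕ))) *
          Real.sqrt (((V₁G L raw st.1 st.2 hlab s).card : ℝ) * ((V₂G L raw st.1 st.2 hlab s).card : ℝ))
        < ((Finset.univ.filter fun e : CLeg c => pI I c F0 F1 F2 hF st.1 st.2 hlab e = some s).card : ℝ)) ∧
      (∀ s : Fin st.2, (V₁G L raw st.1 st.2 hlab s).card + (V₂G L raw st.1 st.2 hlab s).card
        ≤ 2 * (Finset.univ.filter fun e : CLeg c => pI I c F0 F1 F2 hF st.1 st.2 hlab e = some s).card) := by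
  rw [← sqrt_gRsq]
  exact decomposition_clausesI I c F0 F1 F2 hF L (gRsq ℓ t) cap t₀ u₁ hu₁ hcap u₂ hu₂

end WithF

end Summit.PneNP.PneNP.Theorems.Sd2BlMachine
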